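/-
Copyright (c) 2026 the pub-hodgecm-mathlib formalisation cell (harness21).  Prover seat hodgecm-mathlib-K2Liu-p03 (g7): Track B «K2-LIT», hLiu418 = stmt-HodgeConjecture-24832,
road `K2_Liu`, socket #42S, organ S4, (asm-3G) FILE G1: LOCAL SIEGEL–WEIL SECTIONS ARE SMOOTH VECTORS — locally constant, continuous, open stabiliser (LEAD BATCH #33 (1)).
-/
import Summits.HodgeConjecture.HodgeConjecture.Theorems.K2LiuSWSectionPlaceFactorisation   -- ★ (S4-glob): record letters `finSplittings … (cmFinLocalFamily …)`, `deltaPair_mem_localMp`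
import Summits.HodgeConjecture.HodgeConjecture.Theorems.K2LiuLocalSWImageDefs            -- ★ `localSWImage`, `mem_localSWImage_iff`
import HarnessLib

/-!
# Crux `HLiu418`, road `K2_Liu`, socket #42S, organ S4, (asm-3G) FILE G1: local Siegel–Weil sections are locally constant

Cell `hodgecm-mathlib`, crux item hLiu418 = `stmt-HodgeConjecture-24832`; squad K2 ∕ K2Liu; prover K2Liu-p03 (g7).  THEOREMS ONLY (no `def`, no instance, no notation,
no named-fact hypothesis, no `sorry`); lane `--supports stmt-HodgeConjecture-24832 --as helper`.

The two «local letters» of LEAD BATCH #33 (1) are IN THE TREE: the local Weil representation `ω_v = toRep ∘ s_v` of every `FinLocalSplittings` is SMOOTH (field ★ `FinLocalSplittings.smooth`,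
built for the record data from ★ `LocalSplittingDatum.smooth`), and `tensorEmbLoc_v : H(L⁺_v) → U(𝔻)(L⁺_v)` is continuous (★ `continuous_tensorEmbLoc`).  Hence a local Siegel–Weil
section `u ↦ F_Y(u) = (ω_v(m₀ · s_v(u ⊗ 1)) Y)(0)` (★ `swSectionTensorLoc`) is right-invariant under the OPEN subgroup `tensorEmbLoc_v⁻¹(Stab_{ω_v}(Y))` of `H(L⁺_v)`
(★ `swSectionTensorLoc_mul_right`), so it is locally constant and continuous; the same for every element of a local Siegel–Weil image (a finite combination).
* §1 `isLocallyConstant_of_forall_mul_eq` — a function on a topological group right-invariant under an open subgroup is locally constant.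
* §2 (generic smooth splitting `s`, `hs : IsSmooth (toRep ∘ s)`): `exists_isOpen_forall_swSectionTensorLoc_mul_eq`, `isLocallyConstant_swSectionTensorLoc`,
  `continuous_swSectionTensorLoc`, and for image elements `exists_isOpen_forall_mul_eq_of_mem_localSWImage`, `continuous_of_mem_localSWImage`.
* §3 the record data: `isSmooth_finSplittings_rec` and the record corollaries `exists_isOpen_forall_mul_eq_of_mem_localSWImage_rec`, `continuous_of_mem_localSWImage_rec`.
[MoeglinVignerasWaldspurger1987, Chap. 2 II.1, II.10]; [KudlaRallis1994, §1]; [HarrisKudlaSweet1996, §1 (1.8)].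
HONEST LABEL.  Count-neutral helper: `HC_CM` is proved only modulo the 7 printed citations (2 remaining named inputs: hLiu418 = `stmt-HodgeConjecture-24832`,
h413 = `stmt-HodgeConjecture-24833`) until rung 0 closes.
-/

set_option autoImplicit false
set_option linter.dupNamespace false -- the mandated namespace repeats `HodgeConjecture.HodgeConjecture`

noncomputable section

open scoped Matrix TensorProduct Classical
open NumberField IsDedekindDomain Filter Topology
open Literature.RepresentationTheory.HeisenbergGroup
open Literature.NumberTheory.Automorphic Literature.NumberTheory.Automorphic.UnitaryGroup Literature.NumberTheory.GaloisRepresentations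
open Literature.NumberTheory.Weil1964 Literature.RepresentationTheory.HarrisKudlaSweet1996
open Literature.NumberTheory.GelbartRogawski1991 Literature.NumberTheory.GelbartRogawski1991.GRConstruction Literature.NumberTheory.GelbartRogawski1991.UnitaryDualPair
open Literature.NumberTheory.GelbartRogawski1991.UnitaryDualPair.LocalSplitting
open Literature.NumberTheory.K2Lit.SiegelDoubled Literature.NumberTheory.K2Lit.LocalSiegelDoubled
open Summit.HodgeConjecture.HodgeConjecture.Cruxes.HLiu418.K2LiuLocalSWSectionDefs Summit.HodgeConjecture.HodgeConjecture.Cruxes.HLiu418.K2LiuLocalSWImageDefs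
open Summit.HodgeConjecture.HodgeConjecture.Cruxes.HLiu418.K2LiuSWSectionPlaceFactorisation

namespace Summit.HodgeConjecture.HodgeConjecture.Cruxes.HLiu418.K2LiuLocalSWSectionSmooth

/-! ## §1 Right-invariance under an open subgroup ⇒ locally constant -/

/-- a function on a topological group that is right-invariant under an OPEN subgroup is locally constant (constant on the open cosets `x·U`). [folklore] -/
theorem isLocallyConstant_of_forall_mul_eq {G X : Type*} [Group G] [TopologicalSpace G] [ContinuousMul G] (U : Subgroup G) (hU : IsOpen (U : Set G))
    (f : G → X) (hf : ∀ g, ∀ u ∈ U, f (g * u) = f g) : IsLocallyConstant f := by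
  refine (IsLocallyConstant.iff_eventually_eq f).2 fun x => ?_
  have hopen : IsOpen ((fun y => x⁻¹ * y) ⁻¹' (U : Set G)) := hU.preimage (continuous_const.mul continuous_id)
  have hx : x ∈ (fun y => x⁻¹ * y) ⁻¹' (U : Set G) := by simp
  filter_upwards [hopen.mem_nhds hx] with y hy
  have h1 := hf x (x⁻¹ * y) hy
  rwa [mul_inv_cancel_left] at h1

/-- … hence continuous (any topology on the target). [folklore] -/
theorem continuous_of_forall_mul_eq {G X : Type*} [Group G] [TopologicalSpace G] [ContinuousMul G] [TopologicalSpace X] (U : Subgroup G)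
    (hU : IsOpen (U : Set G)) (f : G → X) (hf : ∀ g, ∀ u ∈ U, f (g * u) = f g) : Continuous f :=
  (isLocallyConstant_of_forall_mul_eq U hU f hf).continuous

variable (L : Type) [Field L] [NumberField L] [IsCMField L]
variable {N M n : ℕ} (e : Fin N × Fin M ≃ Fin n)
  (dV : Fin N → L) (hdV : ∀ i, IsCMField.complexConj L (dV i) = dV i) (hdV0 : ∀ i, dV i ≠ 0)
  (dW : Fin M → L) (hdW : ∀ i, IsCMField.complexConj L (dW i) = dW i) (hdW0 : ∀ i, dW i ≠ 0)
variable {M₂ M' n' : ℕ} (eW : Fin M × Fin M₂ ≃ Fin M') (e' : Fin N × Fin M' ≃ Fin n')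
  (dV' : Fin M₂ → L) (hdV' : ∀ k, IsCMField.complexConj L (dV' k) = dV' k) (hdV'0 : ∀ k, dV' k ≠ 0)

/-! ## §2 A smooth local splitting: local Siegel–Weil sections are locally constant -/

/-- **OPEN STABILISER**: for a local splitting `s` of `U(𝔻)(L⁺_v)` with `ω_v = toRep ∘ s` smooth, every `F_Y(·) = swSectionTensorLoc … s m₀ Y ·` is right-invariant under the open
subgroup `tensorEmbLoc_v⁻¹(Stab(Y))` of `H(L⁺_v)`. [cite: MoeglinVignerasWaldspurger1987, Chap. 2 II.1] [cite: KudlaRallis1994, §1] -/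
theorem exists_isOpen_forall_swSectionTensorLoc_mul_eq (v : HeightOneSpectrum (𝓞 (Fp L)))
    (s : UnitaryGroup.localPi L (IsCMField.complexConj L) (n' + n') (hermD L e' dV hdV (tensorFrame L dW eW dV') (tensorFrame_real L dW hdW eW dV' hdV')) v →* LocalMp (Fp L) (n' + n') (gramD L e' dV hdV (tensorFrame L dW eW dV') (tensorFrame_real L dW hdW eW dV' hdV')) v)
    (hs : Representation.IsSmooth ((MpPsi.toRep (localSchrodinger (Fp L) (n' + n') (gramD L e' dV hdV (tensorFrame L dW eW dV') (tensorFrame_real L dW hdW eW dV' hdV')) v)).comp s))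
    (m₀ : LocalMp (Fp L) (n' + n') (gramD L e' dV hdV (tensorFrame L dW eW dV') (tensorFrame_real L dW hdW eW dV' hdV')) v) (Y : SchwartzBruhat (Fin (n' + n') → v.adicCompletion (Fp L))) :
    ∃ U : Subgroup (UnitaryGroup.localPi L (IsCMField.complexConj L) (n + n) (hermD L e dV hdV dW hdW) v), IsOpen (U : Set (UnitaryGroup.localPi L (IsCMField.complexConj L) (n + n) (hermD L e dV hdV dW hdW) v)) ∧
      ∀ u, ∀ k ∈ U, swSectionTensorLoc L e dV hdV dW hdW eW e' dV' hdV' v s m₀ Y (u * k) = swSectionTensorLoc L e dV hdV dW hdW eW e' dV' hdV' v s m₀ Y u := by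
  refine ⟨(Representation.stabilizerSubgroup ((MpPsi.toRep (localSchrodinger (Fp L) (n' + n') (gramD L e' dV hdV (tensorFrame L dW eW dV') (tensorFrame_real L dW hdW eW dV' hdV')) v)).comp s) Y).comap
    (tensorEmbLoc L e dV hdV dW hdW eW e' dV' hdV' v), (hs Y).preimage (continuous_tensorEmbLoc L e dV hdV dW hdW eW e' dV' hdV' v), fun u k hk => ?_⟩
  rw [swSectionTensorLoc_mul_right]
  have hk' : ((MpPsi.toRep (localSchrodinger (Fp L) (n' + n') (gramD L e' dV hdV (tensorFrame L dW eW dV') (tensorFrame_real L dW hdW eW dV' hdV')) v)).comp s) (tensorEmbLoc L e dV hdV dW hdW eW e' dV' hdV' v k) Y = Y :=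
    (Representation.mem_stabilizerSubgroup _ _ _).1 (Subgroup.mem_comap.1 hk)
  rw [MonoidHom.comp_apply] at hk'
  rw [hk']

/-- the local Siegel–Weil section `F_Y` is locally constant on `H(L⁺_v)`. [cite: MoeglinVignerasWaldspurger1987, Chap. 2 II.1] [cite: KudlaRallis1994, §1] -/
theorem isLocallyConstant_swSectionTensorLoc (v : HeightOneSpectrum (𝓞 (Fp L)))
    (s : UnitaryGroup.localPi L (IsCMField.complexConj L) (n' + n') (hermD L e' dV hdV (tensorFrame L dW eW dV') (tensorFrame_real L dW hdW eW dV' hdV')) v →* LocalMp (Fp L) (n' + n') (gramD L e' dV hdV (tensorFrame L dW eW dV') (tensorFrame_real L dW hdW eW dV' hdV')) v)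
    (hs : Representation.IsSmooth ((MpPsi.toRep (localSchrodinger (Fp L) (n' + n') (gramD L e' dV hdV (tensorFrame L dW eW dV') (tensorFrame_real L dW hdW eW dV' hdV')) v)).comp s))
    (m₀ : LocalMp (Fp L) (n' + n') (gramD L e' dV hdV (tensorFrame L dW eW dV') (tensorFrame_real L dW hdW eW dV' hdV')) v) (Y : SchwartzBruhat (Fin (n' + n') → v.adicCompletion (Fp L))) :
    IsLocallyConstant (swSectionTensorLoc L e dV hdV dW hdW eW e' dV' hdV' v s m₀ Y) := by
  obtain ⟨U, hU, hUeq⟩ := exists_isOpen_forall_swSectionTensorLoc_mul_eq L e dV hdV dW hdW eW e' dV' hdV' v s hs m₀ Y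
  exact isLocallyConstant_of_forall_mul_eq U hU _ hUeq

/-- the local Siegel–Weil section `F_Y` is continuous on `H(L⁺_v)`. [cite: MoeglinVignerasWaldspurger1987, Chap. 2 II.1] [cite: KudlaRallis1994, §1] -/
theorem continuous_swSectionTensorLoc (v : HeightOneSpectrum (𝓞 (Fp L)))
    (s : UnitaryGroup.localPi L (IsCMField.complexConj L) (n' + n') (hermD L e' dV hdV (tensorFrame L dW eW dV') (tensorFrame_real L dW hdW eW dV' hdV')) v →* LocalMp (Fp L) (n' + n') (gramD L e' dV hdV (tensorFrame L dW eW dV') (tensorFrame_real L dW hdW eW dV' hdV')) v)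
    (hs : Representation.IsSmooth ((MpPsi.toRep (localSchrodinger (Fp L) (n' + n') (gramD L e' dV hdV (tensorFrame L dW eW dV') (tensorFrame_real L dW hdW eW dV' hdV')) v)).comp s))
    (m₀ : LocalMp (Fp L) (n' + n') (gramD L e' dV hdV (tensorFrame L dW eW dV') (tensorFrame_real L dW hdW eW dV' hdV')) v) (Y : SchwartzBruhat (Fin (n' + n') → v.adicCompletion (Fp L))) :
    Continuous (swSectionTensorLoc L e dV hdV dW hdW eW e' dV' hdV' v s m₀ Y) :=
  (isLocallyConstant_swSectionTensorLoc L e dV hdV dW hdW eW e' dV' hdV' v s hs m₀ Y).continuous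

/-- **every element of a local Siegel–Weil image is right-invariant under an open subgroup** (the image is the RANGE of `Y ↦ F_Y`, ★ `mem_localSWImage_iff`).
[cite: MoeglinVignerasWaldspurger1987, Chap. 2 II.1] [cite: KudlaRallis1994, §1] -/
theorem exists_isOpen_forall_mul_eq_of_mem_localSWImage (v : HeightOneSpectrum (𝓞 (Fp L)))
    (s : UnitaryGroup.localPi L (IsCMField.complexConj L) (n' + n') (hermD L e' dV hdV (tensorFrame L dW eW dV') (tensorFrame_real L dW hdW eW dV' hdV')) v →* LocalMp (Fp L) (n' + n') (gramD L e' dV hdV (tensorFrame L dW eW dV') (tensorFrame_real L dW hdW eW dV' hdV')) v)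
    (hs : Representation.IsSmooth ((MpPsi.toRep (localSchrodinger (Fp L) (n' + n') (gramD L e' dV hdV (tensorFrame L dW eW dV') (tensorFrame_real L dW hdW eW dV' hdV')) v)).comp s))
    (m₀ : LocalMp (Fp L) (n' + n') (gramD L e' dV hdV (tensorFrame L dW eW dV') (tensorFrame_real L dW hdW eW dV' hdV')) v) {b : UnitaryGroup.localPi L (IsCMField.complexConj L) (n + n) (hermD L e dV hdV dW hdW) v → ℂ} (hb : b ∈ localSWImage L e dV hdV dW hdW eW e' dV' hdV' v s m₀) :
    ∃ U : Subgroup (UnitaryGroup.localPi L (IsCMField.complexConj L) (n + n) (hermD L e dV hdV dW hdW) v), IsOpen (U : Set (UnitaryGroup.localPi L (IsCMField.complexConj L) (n + n) (hermD L e dV hdV dW hdW) v)) ∧ ∀ u, ∀ k ∈ U, b (u * k) = b u := by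
  obtain ⟨Y, rfl⟩ := (mem_localSWImage_iff L e dV hdV dW hdW eW e' dV' hdV' v s m₀ b).1 hb
  exact exists_isOpen_forall_swSectionTensorLoc_mul_eq L e dV hdV dW hdW eW e' dV' hdV' v s hs m₀ Y

/-- … hence every element of a local Siegel–Weil image is continuous. [cite: MoeglinVignerasWaldspurger1987, Chap. 2 II.1] [cite: KudlaRallis1994, §1] -/
theorem continuous_of_mem_localSWImage (v : HeightOneSpectrum (𝓞 (Fp L)))
    (s : UnitaryGroup.localPi L (IsCMField.complexConj L) (n' + n') (hermD L e' dV hdV (tensorFrame L dW eW dV') (tensorFrame_real L dW hdW eW dV' hdV')) v →* LocalMp (Fp L) (n' + n') (gramD L e' dV hdV (tensorFrame L dW eW dV') (tensorFrame_real L dW hdW eW dV' hdV')) v)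
    (hs : Representation.IsSmooth ((MpPsi.toRep (localSchrodinger (Fp L) (n' + n') (gramD L e' dV hdV (tensorFrame L dW eW dV') (tensorFrame_real L dW hdW eW dV' hdV')) v)).comp s))
    (m₀ : LocalMp (Fp L) (n' + n') (gramD L e' dV hdV (tensorFrame L dW eW dV') (tensorFrame_real L dW hdW eW dV' hdV')) v) {b : UnitaryGroup.localPi L (IsCMField.complexConj L) (n + n) (hermD L e dV hdV dW hdW) v → ℂ} (hb : b ∈ localSWImage L e dV hdV dW hdW eW e' dV' hdV' v s m₀) :
    Continuous b := by
  obtain ⟨U, hU, hUeq⟩ := exists_isOpen_forall_mul_eq_of_mem_localSWImage L e dV hdV dW hdW eW e' dV' hdV' v s hs m₀ hb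
  exact continuous_of_forall_mul_eq U hU b hUeq

/-! ## §3 The record data -/

variable {χb : HeckeCharacter L} (hχbs : IsSplittingChar L 1 χb)

/-- the record local splitting `s_v` of `finSplittings … (cmFinLocalFamily …)` has SMOOTH `ω_v = toRep ∘ s_v` (field ★ `FinLocalSplittings.smooth`).
[cite: MoeglinVignerasWaldspurger1987, Chap. 2 II.1] [cite: GelbartRogawski1991, §3.1 Prop. 3.1.1] -/
theorem isSmooth_finSplittings_rec (v : HeightOneSpectrum (𝓞 (Fp L))) :
    Representation.IsSmooth ((MpPsi.toRep (localSchrodinger (Fp L) (n' + n') (gramD L e' dV hdV (tensorFrame L dW eW dV') (tensorFrame_real L dW hdW eW dV' hdV')) v)).comp ((finSplittings L e' dV hdV hdV0 (tensorFrame L dW eW dV') (tensorFrame_real L dW hdW eW dV' hdV') (tensorFrame_ne_zero L dW eW dV' hdW0 hdV'0) χb (borelPlaceMeasure L) (cmFinLocalFamily L e' dV hdV hdV0 (tensorFrame L dW eW dV') (tensorFrame_real L dW hdW eW dV' hdV') (tensorFrame_ne_zero L dW eW dV' hdW0 hdV'0) χb hχbs (borelPlaceMeasure L))).s v)) :=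
  (finSplittings L e' dV hdV hdV0 (tensorFrame L dW eW dV') (tensorFrame_real L dW hdW eW dV' hdV') (tensorFrame_ne_zero L dW eW dV' hdW0 hdV'0) χb (borelPlaceMeasure L) (cmFinLocalFamily L e' dV hdV hdV0 (tensorFrame L dW eW dV') (tensorFrame_real L dW hdW eW dV' hdV') (tensorFrame_ne_zero L dW eW dV' hdW0 hdV'0) χb hχbs (borelPlaceMeasure L))).smooth v

/-- **record corollary**: every element of the record local Siegel–Weil image `R(dV′, v; rec)` is right-invariant under an open subgroup of `H(L⁺_v)`.
[cite: MoeglinVignerasWaldspurger1987, Chap. 2 II.1] [cite: KudlaRallis1994, §1] -/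
theorem exists_isOpen_forall_mul_eq_of_mem_localSWImage_rec (v : HeightOneSpectrum (𝓞 (Fp L))) {b : UnitaryGroup.localPi L (IsCMField.complexConj L) (n + n) (hermD L e dV hdV dW hdW) v → ℂ}
    (hb : b ∈
      localSWImage L e dV hdV dW hdW eW e' dV' hdV' v ((finSplittings L e' dV hdV hdV0 (tensorFrame L dW eW dV') (tensorFrame_real L dW hdW eW dV' hdV') (tensorFrame_ne_zero L dW eW dV' hdW0 hdV'0) χb (borelPlaceMeasure L) (cmFinLocalFamily L e' dV hdV hdV0 (tensorFrame L dW eW dV') (tensorFrame_real L dW hdW eW dV' hdV') (tensorFrame_ne_zero L dW eW dV' hdW0 hdV'0) χb hχbs (borelPlaceMeasure L))).s v)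
        ⟨(ratSpLoc (Fp L) (n' + n') (gramD L e' dV hdV (tensorFrame L dW eW dV') (tensorFrame_real L dW hdW eW dV' hdV'))
              (isUnit_det_gramD L e' dV hdV hdV0 (tensorFrame L dW eW dV') (tensorFrame_real L dW hdW eW dV' hdV') (tensorFrame_ne_zero L dW eW dV' hdW0 hdV'0)) v (deltaD L),
            deltaImpl L e' dV hdV hdV0 (tensorFrame L dW eW dV') (tensorFrame_real L dW hdW eW dV' hdV') (tensorFrame_ne_zero L dW eW dV' hdW0 hdV'0) χb (borelPlaceMeasure L) (cmFinLocalFamily L e' dV hdV hdV0 (tensorFrame L dW eW dV') (tensorFrame_real L dW hdW eW dV' hdV') (tensorFrame_ne_zero L dW eW dV' hdW0 hdV'0) χb hχbs (borelPlaceMeasure L)) v),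
          deltaPair_mem_localMp L e' dV hdV hdV0 (tensorFrame L dW eW dV') (tensorFrame_real L dW hdW eW dV' hdV') (tensorFrame_ne_zero L dW eW dV' hdW0 hdV'0) χb (borelPlaceMeasure L) (cmFinLocalFamily L e' dV hdV hdV0 (tensorFrame L dW eW dV') (tensorFrame_real L dW hdW eW dV' hdV') (tensorFrame_ne_zero L dW eW dV' hdW0 hdV'0) χb hχbs (borelPlaceMeasure L)) v⟩) :
    ∃ U : Subgroup (UnitaryGroup.localPi L (IsCMField.complexConj L) (n + n) (hermD L e dV hdV dW hdW) v), IsOpen (U : Set (UnitaryGroup.localPi L (IsCMField.complexConj L) (n + n) (hermD L e dV hdV dW hdW) v)) ∧ ∀ u, ∀ k ∈ U, b (u * k) = b u :=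
  exists_isOpen_forall_mul_eq_of_mem_localSWImage L e dV hdV dW hdW eW e' dV' hdV' v _ (isSmooth_finSplittings_rec L dV hdV hdV0 dW hdW hdW0 eW e' dV' hdV' hdV'0 hχbs v) _ hb

/-- **record corollary**: every element of `R(dV′, v; rec)` is continuous on `H(L⁺_v)`. [cite: MoeglinVignerasWaldspurger1987, Chap. 2 II.1] [cite: KudlaRallis1994, §1] -/
theorem continuous_of_mem_localSWImage_rec (v : HeightOneSpectrum (𝓞 (Fp L))) {b : UnitaryGroup.localPi L (IsCMField.complexConj L) (n + n) (hermD L e dV hdV dW hdW) v → ℂ}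
    (hb : b ∈
      localSWImage L e dV hdV dW hdW eW e' dV' hdV' v ((finSplittings L e' dV hdV hdV0 (tensorFrame L dW eW dV') (tensorFrame_real L dW hdW eW dV' hdV') (tensorFrame_ne_zero L dW eW dV' hdW0 hdV'0) χb (borelPlaceMeasure L) (cmFinLocalFamily L e' dV hdV hdV0 (tensorFrame L dW eW dV') (tensorFrame_real L dW hdW eW dV' hdV') (tensorFrame_ne_zero L dW eW dV' hdW0 hdV'0) χb hχbs (borelPlaceMeasure L))).s v)
        ⟨(ratSpLoc (Fp L) (n' + n') (gramD L e' dV hdV (tensorFrame L dW eW dV') (tensorFrame_real L dW hdW eW dV' hdV'))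
              (isUnit_det_gramD L e' dV hdV hdV0 (tensorFrame L dW eW dV') (tensorFrame_real L dW hdW eW dV' hdV') (tensorFrame_ne_zero L dW eW dV' hdW0 hdV'0)) v (deltaD L),
            deltaImpl L e' dV hdV hdV0 (tensorFrame L dW eW dV') (tensorFrame_real L dW hdW eW dV' hdV') (tensorFrame_ne_zero L dW eW dV' hdW0 hdV'0) χb (borelPlaceMeasure L) (cmFinLocalFamily L e' dV hdV hdV0 (tensorFrame L dW eW dV') (tensorFrame_real L dW hdW eW dV' hdV') (tensorFrame_ne_zero L dW eW dV' hdW0 hdV'0) χb hχbs (borelPlaceMeasure L)) v),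
          deltaPair_mem_localMp L e' dV hdV hdV0 (tensorFrame L dW eW dV') (tensorFrame_real L dW hdW eW dV' hdV') (tensorFrame_ne_zero L dW eW dV' hdW0 hdV'0) χb (borelPlaceMeasure L) (cmFinLocalFamily L e' dV hdV hdV0 (tensorFrame L dW eW dV') (tensorFrame_real L dW hdW eW dV' hdV') (tensorFrame_ne_zero L dW eW dV' hdW0 hdV'0) χb hχbs (borelPlaceMeasure L)) v⟩) :
    Continuous b :=
  continuous_of_mem_localSWImage L e dV hdV dW hdW eW e' dV' hdV' v _ (isSmooth_finSplittings_rec L dV hdV hdV0 dW hdW hdW0 eW e' dV' hdV' hdV'0 hχbs v) _ hb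

end Summit.HodgeConjecture.HodgeConjecture.Cruxes.HLiu418.K2LiuLocalSWSectionSmooth

end
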